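import Literature.Probability.RandomPlanarGeometry.CritPercSLE
import Literature.Probability.RandomPlanarGeometry.LoewnerInverseCocycle
import Literature.Probability.RandomPlanarGeometry.LoewnerTraceLimit
import Literature.Probability.RandomPlanarGeometry.LoewnerAdapted
import Literature.Probability.RandomPlanarGeometry.SLEBoundaryHittingProofs
import Literature.Probability.Process.PathRegularization
import HarnessLib

/-!
# The simple phase `κ ≤ 4` of the SLE trace (Rohde–Schramm, Thm. 6.1): reduction to two named facts

Topic `Probability/RandomPlanarGeometry`. The named fact
`Literature.Probability.RandomPlanarGeometry.ae_isSimpleTrace_sleTrace_of_le_four` (`CritPercSLE.lean`,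
**crit-perc.S20**; S. Rohde, O. Schramm, *Basic properties of SLE*, Ann. Math. 161 (2005),
Thm. 6.1, p. 901: "In the range `κ ∈ [0, 4]`, the SLE_κ trace `γ` is a.s. a simple path and
`γ[0, ∞) ⊂ ℍ ∪ {0}`"; G. F. Lawler, *Conformally Invariant Processes in the Plane* (2005),
Prop. 6.9) is **reduced, by a proved theorem, to exactly two named facts**:

* `Literature.Probability.RandomPlanarGeometry.hasSLETrace_of_ne_eight` (`SLE.lean`; Rohde–Schramm
  Thm. 5.1: SLE_κ, `κ ≠ 8`, is a.s. generated by a curve; in the tree already reduced to Thm. 3.6,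
  `RohdeSchramm2005_thm36`, by `hasSLETrace_of_ne_eight_of_thm36`). It is genuinely part of the
  content of the target: `sleTrace` is the junk constant path when the chain is not generated by
  a curve (`Loewner.trace`), which is not injective.
* `Literature.Probability.RandomPlanarGeometry.sle_swallowingTime_ofReal_eq_top` (**new**, this
  file; Lawler (2005), Prop. 6.8, first item, p. 150: "If `κ ≤ 4`, then w.p.1 `T_x = ∞` for all
  `x > 0`"; this is the sentence "a.s. for every `x > 0` we have `Y_x(t)` well defined and in
  `(0, ∞)` for all `t ≥ 0`" of the proof of Rohde–Schramm's Lemma 6.2, p. 901, the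
  Bessel-process dichotomy for `Y_x(t) = gₜ(x) - ξ(t)`, `Y_x/√κ ∼ BES(1 + 4/κ)`).

`ae_isSimpleTrace_sleTrace_of_le_four_of_facts` is the assembly. Everything between the two facts
and the target is **proved** here, following the printed proof of Thm. 6.1 (p. 902) / Lawler's
proof of Prop. 6.9:

1. *Markov shift of the driving function* (Rohde–Schramm Prop. 2.1 (ii); Lawler p. 150 "the
   distribution of `γˢ` is the same as that of `γ`", at the level of driving functions): for
   every `s`, `u ↦ ξ(s + u) - ξ(s)` has the law of `ξ = √κ B` on the path space
   (`identDistrib_sleDriving_shift`, from Mathlib's weak Markov property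
   `IsPreBrownianReal.shift` via `identDistrib_sleDriving_transform`), and so does
   `-ξ(s + ·) + ξ(s)` (`identDistrib_sleDriving_neg_shift`, `IsPreBrownianReal.neg`).
2. *Transfer of "no positive real point is swallowed" along an identity in law*
   (`Loewner.ae_forall_swallowingTime_eq_top_of_identDistrib`): the event is read on the path space
   through the measurable regularisation `Literature.Probability.Process.pathRegularize` (which
   fixes continuous paths), where it is measurable by
   `Loewner.measurableSet_lt_swallowingTime` (`LoewnerAdapted.lean`) and monotonicity of `T_x` in
   `x` (`swallowingTime_mono_right`). Hence, from the new fact: for every `s`, a.s. the shifted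
   chain swallows no real point other than its starting point
   (`ae_forall_swallowingTime_shift_eq_top`; negative points by the reflection
   `swallowingTime_neg_ofReal`).
3. *"Applying `g_s⁻¹`"* (deterministic, `Loewner.IsGeneratedByCurve.apply_add_mem_domain_or_eq`):
   if the chain of a continuous `W` is generated by `γ` and the chain of `V = W(s + ·)` swallows
   no real point other than `W s`, then for every `t`, `γ(s + t) ∈ H_s` or `γ(s + t) = γ(s)`.
   This is Rohde–Schramm's "a.s. for every rational `s > 0`, `γ[s, ∞) ∩ (ℝ ∪ K_s) = {γ(s)}`",
   obtained here *without* a trace for the shifted chain: `γ(s + t) = lim_{w → W(s+t)} f_{s+t}(w)`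
   (`IsGeneratedByCurve.tendsto_invFunOn_map`), `f_{s+t} = f_s ∘ f^V_t` (`loewnerInv_add`), the
   points `f^V_t(w)` stay bounded (`tendsto_map_sub_self`), a cluster point in `ℍₒ` is pulled back
   by the continuous `f_s`, and a real cluster point `x` is swallowed by time `t`
   (`continuousAt_map` at real points: `g_t(f^V_t w) = w → V t ≠ g_t(x)`), hence equals `W s`.
4. *Strict growth of hulls* (Rohde–Schramm: "since `g_{t₂} ∘ g_{t₁}⁻¹` is not the identity … there
   is some rational `s ∈ (t₁, t₂)` with `γ(s) ∉ ℝ ∪ K_{t₁}`"): `IsGeneratedByCurve.exists_mem_domain`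
   of `LoewnerTraceLimit.lean`, made rational by openness of `H_{t₁}`
   (`IsGeneratedByCurve.exists_rat_mem_domain`); whence simplicity
   (`IsGeneratedByCurve.isSimpleTrace_of_shift`): `γ(t₂) ∈ H_s ∪ {γ(s)} ⊆ H_{t₁}` is off
   `γ[0, t₁]`.

Also proved: Rohde–Schramm's **Lemma 6.2 as printed** ("`κ ∈ [0, 4]` ⇒ a.s. `γ[0, ∞) ⊂ ℍ ∪ {0}`")
from the new fact alone (`ae_sleTrace_im_pos_or_eq_zero`), through "swallowing of real points =
hitting of real rays" (`Loewner.swallowingTime_ofReal_eq_firstHit_of_ne`, Lawler Rem. 6.6).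

What is NOT here: the discharge of the two facts (Thm. 3.6 is a separate programme; Prop. 6.8 (i)
needs the Itô steps for `(Y_{t∧σ})^{1-4/κ}`, `κ < 4`, `0 < x₁`, and `log Y_{t∧σ}`, `κ = 4`, cf.
`SLEOnePointMartingale.lean` for `κ > 4`).

## References

* S. Rohde, O. Schramm, *Basic properties of SLE*, Ann. of Math. 161 (2005) 883–924
  (arXiv:math/0106036): Prop. 2.1, Thm. 5.1, Thm. 6.1 and Lemma 6.2 with proofs (pp. 901–902).
* G. F. Lawler, *Conformally Invariant Processes in the Plane*, AMS Math. Surveys 114 (2005):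
  Def. 6.1 (`κ ≥ 0`), §6.2, Prop. 6.8 and Prop. 6.9 (p. 150), Prop. 1.21, Rem. 6.6.
-/

noncomputable section

open Set Filter Topology MeasureTheory ProbabilityTheory Complex Metric
open UpperHalfPlane (upperHalfPlaneSet isOpen_upperHalfPlaneSet)
open scoped NNReal

namespace Literature.Probability.RandomPlanarGeometry

/-! ### The named fact: no positive real point is swallowed for `κ ≤ 4` -/

/-- **Lawler (2005), Prop. 6.8, first item** (p. 150): "If `κ ≤ 4`, then w.p.1 `T_x = ∞` for all
`x > 0`." ("This is a restatement of Proposition 1.21 with `a = 2/κ`": the real flow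
`X_t = g_t(x) - √κ B_t` is a Bessel-type process `dX = (2/X) dt - √κ dB`, and a Bessel process of
dimension `1 + 4/κ ≥ 2` does not hit `0`.) Equivalently the sentence "a.s. for every `x > 0` we
have `Y_x(t)` well defined and in `(0, ∞)` for all `t ≥ 0`" of the proof of Rohde–Schramm
(2005), Lemma 6.2 (p. 901). In the tree's terms (chordal SLE_κ with `κ ≥ 0` as in Lawler's
Def. 6.1, driving function `sleDriving κ ω = √κ B(ω)` on the canonical space, swallowing time
`Loewner.swallowingTime` = lifetime of the real Loewner flow `ġ = 2/(g - W)` started at `x`):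
for `κ ≤ 4`, almost surely every real `x > 0` has `T_x = ⊤`. Companion of
`sle_swallowingTime_ofReal_lt_top` (the second item, `κ > 4`). Named fact (closed `Prop`; its
printed proof is the optional-stopping argument of Lawler's Prop. 1.21 / Rohde–Schramm's
Lemma 6.2 for the martingales `(X_{t∧σ})^{1-4/κ}` (`κ < 4`) and `log X_{t∧σ}` (`κ = 4`)).
[cite: Lawler2005, Prop. 6.8] -/
def sle_swallowingTime_ofReal_eq_top : Prop :=
  ∀ {κ : ℝ≥0}, κ ≤ 4 →
    ∀ᵐ ω ∂Process.preWienerMeasure, ∀ x : ℝ, 0 < x → Loewner.swallowingTime (sleDriving κ ω) x = ⊤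

namespace Loewner

variable {W : ℝ≥0 → ℝ} {γ : ℝ≥0 → ℂ}

/-! ### Deterministic step 1: cluster points of the backward flow at the driving point -/

/-- In a Hausdorff space a cluster value of a convergent function is its limit. [folklore] -/
theorem mapClusterPt_eq_of_tendsto {α X : Type*} [TopologicalSpace X] [T2Space X] {L : Filter α}
    {u : α → X} {y z : X} (h : MapClusterPt y L u) (hu : Tendsto u L (𝓝 z)) : y = z :=
  t2_iff_nhds.mp ‹_› (h.clusterPt.mono hu)

/-- Before its swallowing time a point (real or not) is off the driving value: `gₜ(z) ≠ W t` for
`t < T_z` (solutions avoid the singularity, `IsSolution.ne`). [folklore] -/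
theorem map_ne_driving (hW : Continuous W) {z : ℂ} {t : ℝ≥0}
    (hz : (t : WithTop ℝ≥0) < swallowingTime W z) : map W t z ≠ W t := by
  obtain ⟨g, hg⟩ := exists_isSolution_swallowingTime_holds hW (ne_driving_of_lt_swallowingTime hz)
  rw [map_eq_of_isSolution hW hg hz]
  simpa using hg.ne (t := t) t.coe_nonneg (by simpa using hz)

/-- **Real cluster points of the backward flow at the driving point are swallowed points.** Let
`W` be continuous, `t ≥ 0`, and let the real `x` be a cluster point of `fₜ(w) = gₜ⁻¹(w)` as
`w → W t` within `ℍₒ`. Then `T_x ≤ t`: otherwise `gₜ` is continuous at `x` with `gₜ(x) ≠ W t`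
(`continuousAt_map`, `map_ne_driving`), while `gₜ(fₜ w) = w → W t`. [folklore] -/
theorem swallowingTime_le_of_mapClusterPt (hW : Continuous W) {t : ℝ≥0} {x : ℝ}
    (hx : MapClusterPt (x : ℂ) (𝓝[upperHalfPlaneSet] (W t : ℂ)) (loewnerInv W t)) :
    swallowingTime W x ≤ t := by
  by_contra hlt
  rw [not_le] at hlt
  have h1 : MapClusterPt (map W t x) (𝓝[upperHalfPlaneSet] (W t : ℂ)) (map W t ∘ loewnerInv W t) :=
    hx.continuousAt_comp (continuousAt_map hW hlt)
  have h2 : (map W t ∘ loewnerInv W t) =ᶠ[𝓝[upperHalfPlaneSet] (W t : ℂ)] id := by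
    filter_upwards [self_mem_nhdsWithin] with w hw
    exact map_loewnerInv hW t hw
  have h3 : MapClusterPt (map W t x) (𝓝[upperHalfPlaneSet] (W t : ℂ)) id :=
    h2.mapClusterPt_iff.1 h1
  have h4 : Tendsto id (𝓝[upperHalfPlaneSet] (W t : ℂ)) (𝓝 (W t : ℂ)) := nhdsWithin_le_nhds
  exact map_ne_driving hW hlt (mapClusterPt_eq_of_tendsto h3 h4)

/-- Near the driving point the backward flow stays bounded: there is `R` with `‖fₜ w‖ ≤ R` for
all `w ∈ ℍₒ` close to `W t` (because `gₜ(z) - z → 0` as `z → ∞`, `tendsto_map_sub_self`, and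
`gₜ(fₜ w) = w`). [folklore] -/
theorem exists_forall_norm_loewnerInv_le (hW : Continuous W) (t : ℝ≥0) :
    ∃ R : ℝ, ∀ᶠ w in 𝓝[upperHalfPlaneSet] (W t : ℂ), ‖loewnerInv W t w‖ ≤ R := by
  have h1 : ∀ᶠ z in cocompact ℂ ⊓ 𝓟 upperHalfPlaneSet, ‖map W t z - z‖ < 1 := by
    have := tendsto_map_sub_self_holds hW t (Metric.ball_mem_nhds 0 one_pos)
    filter_upwards [this] with z hz
    simpa using hz
  rw [Filter.eventually_inf_principal, ← Metric.cobounded_eq_cocompact] at h1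
  obtain ⟨r, -, hr⟩ := (Metric.hasBasis_cobounded_compl_closedBall (0 : ℂ)).eventually_iff.1 h1
  refine ⟨max r (‖(W t : ℂ)‖ + 2), ?_⟩
  filter_upwards [mem_nhdsWithin_of_mem_nhds (Metric.ball_mem_nhds _ one_pos),
    self_mem_nhdsWithin] with w hw1 hw2
  by_contra hR
  rw [not_le] at hR
  set z := loewnerInv W t w with hz
  have hzr : z ∈ (closedBall (0 : ℂ) r)ᶜ := by
    rw [mem_compl_iff, mem_closedBall, dist_zero_right, not_le]
    exact lt_of_le_of_lt (le_max_left _ _) hR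
  have h3 := hr hzr (im_loewnerInv_pos hW t hw2)
  rw [hz, map_loewnerInv hW t hw2] at h3
  have h5 : ‖z‖ ≤ ‖w‖ + ‖w - z‖ := by
    calc ‖z‖ = ‖w - (w - z)‖ := by rw [sub_sub_cancel]
      _ ≤ ‖w‖ + ‖w - z‖ := norm_sub_le _ _
  have h6 : ‖w‖ ≤ ‖(W t : ℂ)‖ + dist w (W t) := by
    calc ‖w‖ = ‖(W t : ℂ) + (w - W t)‖ := by rw [add_sub_cancel]
      _ ≤ ‖(W t : ℂ)‖ + ‖w - W t‖ := norm_add_le _ _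
      _ = ‖(W t : ℂ)‖ + dist w (W t) := by rw [dist_eq_norm]
  have h7 : dist w (W t) < 1 := hw1
  have h8 : ‖w - z‖ < 1 := by rw [← hz] at h3; exact h3
  linarith [le_max_right r (‖(W t : ℂ)‖ + 2)]

/-! ### Deterministic step 2: pulling the shifted chain back through `g_s` -/

/-- **"Applying `g_s⁻¹`"** (Rohde–Schramm (2005), proof of Thm. 6.1, p. 902, in a form not
requiring a trace for the shifted chain). Let `W` be continuous with chain generated by `γ`,
`s ≥ 0`, `V = W(s + ·)` the shifted driving function, and assume that no real point other than
`V 0 = W s` is ever swallowed by the chain of `V` (`T_x(V) = ⊤` for real `x ≠ W s`; for SLE this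
is Lemma 6.2 / Lawler's Prop. 6.8 (i) for the shifted Brownian motion). Then for every `t`,
either `γ(s + t) ∈ H_s` or `γ(s + t) = γ(s)`. Proof: `γ(s + t) = lim_{w → W(s+t), w ∈ ℍₒ} f_{s+t}(w)`
(`IsGeneratedByCurve.tendsto_invFunOn_map`) and `f_{s+t} = f_s ∘ f^V_t` on `ℍₒ`
(`loewnerInv_add`); the points `f^V_t(w)` stay in a compact part of `ℍ̄ₒ`
(`exists_forall_norm_loewnerInv_le`); a cluster point in `ℍₒ` gives `γ(s + t) = f_s(·) ∈ H_s` by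
continuity of `f_s` on `ℍₒ`; otherwise every cluster point is real, hence swallowed by time `t`
(`swallowingTime_le_of_mapClusterPt`), hence equal to `W s`, so `f^V_t(w) → W s` within `ℍₒ`
and `γ(s + t) = lim_{z → W s} f_s(z) = γ(s)`. [cite: RohdeSchramm2005, proof of Thm 6.1 (p. 902)] -/
theorem IsGeneratedByCurve.apply_add_mem_domain_or_eq (hW : Continuous W)
    (hγ : IsGeneratedByCurve W γ) {s : ℝ≥0}
    (hreal : ∀ x : ℝ, x ≠ W s → swallowingTime (fun u ↦ W (s + u)) x = ⊤) (t : ℝ≥0) :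
    γ (s + t) ∈ domain W s ∨ γ (s + t) = γ s := by
  set V : ℝ≥0 → ℝ := fun u ↦ W (s + u) with hV
  have hVc : Continuous V := continuous_shift W hW s
  have hVt : (V t : ℂ) = W (s + t) := rfl
  set L : Filter ℂ := 𝓝[upperHalfPlaneSet] (W (s + t) : ℂ) with hL
  haveI : NeBot L := neBot_nhdsWithin_ofReal _
  set Z : ℂ → ℂ := loewnerInv V t with hZ
  -- the tip at time `s + t` as the limit of `f_s ∘ Z`
  have hlim : Tendsto (loewnerInv W s ∘ Z) L (𝓝 (γ (s + t))) := by
    refine (hγ.tendsto_invFunOn_map hW (s + t)).congr' ?_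
    filter_upwards [self_mem_nhdsWithin] with w hw
    exact loewnerInv_add hW s t hw
  -- `Z` is valued in `ℍₒ` and eventually bounded along `L`
  obtain ⟨R, hR⟩ := exists_forall_norm_loewnerInv_le hVc t
  rw [hVt] at hR
  have hmem : ∀ᶠ w in L, Z w ∈ closedBall (0 : ℂ) R ∩ {z : ℂ | 0 ≤ z.im} := by
    filter_upwards [hR, self_mem_nhdsWithin] with w hw1 hw2
    exact ⟨mem_closedBall_zero_iff.2 hw1, (im_loewnerInv_pos hVc t hw2).le⟩
  have hK : IsCompact (closedBall (0 : ℂ) R ∩ {z : ℂ | 0 ≤ z.im}) :=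
    (isCompact_closedBall _ _).inter_right (isClosed_le continuous_const Complex.continuous_im)
  by_cases hcl : ∃ z : ℂ, 0 < z.im ∧ MapClusterPt z L Z
  · -- a cluster point in `ℍₒ`: pull it back by the continuous `f_s`
    obtain ⟨z, hz, hzc⟩ := hcl
    left
    have h1 : MapClusterPt (loewnerInv W s z) L (loewnerInv W s ∘ Z) :=
      hzc.continuousAt_comp (continuousAt_loewnerInv hW s hz)
    rw [← mapClusterPt_eq_of_tendsto h1 hlim]
    exact loewnerInv_mem_domain hW s hz
  · -- every cluster point is real, hence swallowed by time `t`, hence equal to `W s`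
    right
    push Not at hcl
    have huniq : ∀ z ∈ closedBall (0 : ℂ) R ∩ {z : ℂ | 0 ≤ z.im}, MapClusterPt z L Z →
        z = (W s : ℂ) := by
      rintro z ⟨-, hz0⟩ hzc
      have hzim : z.im = 0 := le_antisymm (not_lt.1 fun h ↦ hcl z h hzc) hz0
      have hzre : ((z.re : ℝ) : ℂ) = z := Complex.ext (by simp) (by simp [hzim])
      rw [← hzre] at hzc ⊢
      have hzc' : MapClusterPt ((z.re : ℝ) : ℂ) (𝓝[upperHalfPlaneSet] (V t : ℂ)) (loewnerInv V t) := by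
        rw [hVt]; exact hzc
      have hT : swallowingTime V z.re ≤ t := swallowingTime_le_of_mapClusterPt hVc hzc'
      by_contra hne
      have hne' : z.re ≠ W s := fun h ↦ hne (by rw [h])
      rw [hreal z.re hne'] at hT
      exact absurd hT (not_le.2 (WithTop.coe_lt_top t))
    have hZlim : Tendsto Z L (𝓝 (W s : ℂ)) := hK.tendsto_nhds_of_unique_mapClusterPt hmem huniq
    have hZlim' : Tendsto Z L (𝓝[upperHalfPlaneSet] (W s : ℂ)) := by
      refine tendsto_nhdsWithin_iff.2 ⟨hZlim, ?_⟩
      filter_upwards [self_mem_nhdsWithin] with w hw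
      exact im_loewnerInv_pos hVc t hw
    have h2 : Tendsto (loewnerInv W s ∘ Z) L (𝓝 (γ s)) :=
      (hγ.tendsto_invFunOn_map hW s).comp hZlim'
    exact tendsto_nhds_unique hlim h2

/-! ### Deterministic step 3: strict growth of hulls and simplicity -/

/-- **Strict growth, rational form** (Rohde–Schramm (2005), proof of Thm. 6.1, p. 902: "there is
some `s ∈ (t₁, t₂)` such that `γ(s) ∉ ℝ ∪ K_{t₁}`, and this holds for an open set of `s` … in
particular, there is some rational `s`"). For `a < b` there is a rational time `q ∈ (a, b)` with
`γ q ∈ H_a`: `IsGeneratedByCurve.exists_mem_domain` (hulls grow strictly), openness of `H_a` and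
continuity of `γ`. [cite: RohdeSchramm2005, proof of Thm 6.1 (p. 902)] -/
theorem IsGeneratedByCurve.exists_rat_mem_domain (hW : Continuous W) (hγ : IsGeneratedByCurve W γ)
    {a b : ℝ≥0} (hab : a < b) :
    ∃ q : ℚ, a < (q : ℝ).toNNReal ∧ (q : ℝ).toNNReal < b ∧ γ ((q : ℝ).toNNReal) ∈ domain W a := by
  have hab' : (a : ℝ) < b := NNReal.coe_lt_coe.2 hab
  obtain ⟨s, has, hsb, hs⟩ := hγ.exists_mem_domain hW a (sub_pos.2 hab')
  have hsb' : (s : ℝ) < b := by linarith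
  have hopen : IsOpen (γ ⁻¹' domain W a) := (isOpen_domain hW a).preimage hγ.continuous
  obtain ⟨ε, hε, hball⟩ := Metric.isOpen_iff.1 hopen s hs
  obtain ⟨q, hq1, hq2⟩ := exists_rat_btwn (lt_min hsb' (show (s : ℝ) < s + ε by linarith))
  have hq0 : (0 : ℝ) ≤ q := le_trans s.coe_nonneg hq1.le
  have hqs : ((q : ℝ).toNNReal : ℝ) = q := Real.coe_toNNReal _ hq0
  refine ⟨q, ?_, ?_, hball ?_⟩
  · rw [← NNReal.coe_lt_coe, hqs]
    exact lt_trans (NNReal.coe_lt_coe.2 has) hq1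
  · rw [← NNReal.coe_lt_coe, hqs]
    exact lt_of_lt_of_le hq2 (min_le_left _ _)
  · rw [Metric.mem_ball, NNReal.dist_eq, hqs, abs_sub_lt_iff]
    constructor <;> linarith [lt_of_lt_of_le hq2 (min_le_right _ _)]

/-- **Simplicity of the generating curve from the Markov shifts** (Rohde–Schramm (2005), proof
of Thm. 6.1, p. 902, deterministic skeleton; Lawler (2005), proof of Prop. 6.9). Let `W` be
continuous with chain generated by `γ` and assume that for every positive rational time `q` and
every `t ≥ 0`, `γ(q + t) ∈ H_q` or `γ(q + t) = γ(q)` (the output of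
`apply_add_mem_domain_or_eq`). Then `γ` is a simple trace: for `a < b` pick a rational
`q ∈ (a, b)` with `γ(q) ∈ H_a` (`exists_rat_mem_domain`); then `γ(b) ∈ H_q ∪ {γ q} ⊆ H_a`
(`domain_antitone`), while `γ(a) ∈ γ[0, a]` is off `H_a` (`domain_subset_diff`); so `γ a ≠ γ b`,
and (`a = 0`) `γ b ∈ H_0 ⊆ ℍₒ`. [cite: RohdeSchramm2005, proof of Thm 6.1 (p. 902)] -/
theorem IsGeneratedByCurve.isSimpleTrace_of_shift (hW : Continuous W) (hγ : IsGeneratedByCurve W γ)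
    (h : ∀ q : ℚ, 0 < q → ∀ t : ℝ≥0,
      γ ((q : ℝ).toNNReal + t) ∈ domain W ((q : ℝ).toNNReal) ∨
        γ ((q : ℝ).toNNReal + t) = γ ((q : ℝ).toNNReal)) :
    IsSimpleTrace γ := by
  -- key consequence: the curve at a later time lies in every earlier Loewner domain
  have key : ∀ {a b : ℝ≥0}, a < b → γ b ∈ domain W a := by
    intro a b hab
    obtain ⟨q, haq, hqb, hq⟩ := hγ.exists_rat_mem_domain hW hab
    have hq0 : (0 : ℚ) < q := by
      have h1 : (0 : ℝ≥0) < (q : ℝ).toNNReal := lt_of_le_of_lt (zero_le (a := a)) haq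
      have h2 : (0 : ℝ) < q := by simpa using h1
      exact_mod_cast h2
    have hsum : (q : ℝ).toNNReal + (b - (q : ℝ).toNNReal) = b := add_tsub_cancel_of_le hqb.le
    rcases h q hq0 (b - (q : ℝ).toNNReal) with h1 | h1
    · rw [hsum] at h1
      exact domain_antitone W haq.le h1
    · rw [hsum] at h1
      rw [h1]
      exact hq
  refine ⟨fun a b hab ↦ ?_, fun t ht ↦ domain_subset W 0 (key ht)⟩
  by_contra hne
  rcases lt_or_gt_of_ne hne with hlt | hlt
  · have h1 := key hlt
    rw [← hab] at h1
    exact (hγ.domain_subset_diff a h1).2 ⟨a, ⟨zero_le (a := a), le_rfl⟩, rfl⟩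
  · have h1 := key hlt
    rw [hab] at h1
    exact (hγ.domain_subset_diff b h1).2 ⟨b, ⟨zero_le (a := b), le_rfl⟩, rfl⟩

/-- **The trace is simple** for a continuous driving function whose chain is generated by a
curve, provided that for every positive rational `q` the shifted chain (driving function
`W(q + ·)`) swallows no real point other than its starting point `W q`
(`apply_add_mem_domain_or_eq` and `isSimpleTrace_of_shift`). The deterministic content of
Rohde–Schramm (2005), proof of Thm. 6.1. [cite: RohdeSchramm2005, proof of Thm 6.1 (p. 902)] -/
theorem isSimpleTrace_trace_of_shift (hW : Continuous W) (hgen : ∃ γ, IsGeneratedByCurve W γ)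
    (hreal : ∀ q : ℚ, 0 < q → ∀ x : ℝ, x ≠ W ((q : ℝ).toNNReal) →
      swallowingTime (fun u ↦ W ((q : ℝ).toNNReal + u)) x = ⊤) :
    IsSimpleTrace (trace W) :=
  have hγ := isGeneratedByCurve_trace hgen
  hγ.isSimpleTrace_of_shift hW fun q hq t ↦ hγ.apply_add_mem_domain_or_eq hW (hreal q hq) t

/-! ### Transfer of "no positive real point is swallowed" along an identity in law -/

/-- **Law transfer for the non-swallowing event.** Let `W₁, W₂ : Ω → (ℝ≥0 → ℝ)` be two families of
continuous driving paths started at `0`, identically distributed as random elements of the path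
space (product σ-algebra). If a.s. no positive real point is swallowed by the chain of `W₁ ω`,
the same holds for `W₂`. The event is read on the path space through the regularised path
`pathRegularize w - pathRegularize w 0` (`Literature.Probability.Process.pathRegularize`: measurable
in `w`, continuous in time, and equal to `w` for continuous `w` with `w 0 = 0`), for which
`{m < T_{1/(n+1)}}` is measurable (`measurableSet_lt_swallowingTime`); for continuous paths
"`∀ x > 0, T_x = ⊤`" is "`∀ n m, m < T_{1/(n+1)}`" by monotonicity of `T_x` in `x`
(`swallowingTime_mono_right`). [folklore] -/
theorem ae_forall_swallowingTime_eq_top_of_identDistrib {Ω : Type*} [MeasurableSpace Ω]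
    {P : Measure Ω} {W₁ W₂ : Ω → ℝ≥0 → ℝ} (hc₁ : ∀ ω, Continuous (W₁ ω))
    (hc₂ : ∀ ω, Continuous (W₂ ω)) (h0₁ : ∀ ω, W₁ ω 0 = 0) (h0₂ : ∀ ω, W₂ ω 0 = 0)
    (hid : IdentDistrib W₁ W₂ P P)
    (h : ∀ᵐ ω ∂P, ∀ x : ℝ, 0 < x → swallowingTime (W₁ ω) x = ⊤) :
    ∀ᵐ ω ∂P, ∀ x : ℝ, 0 < x → swallowingTime (W₂ ω) x = ⊤ := by
  -- the regularised path, recentred at time `0`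
  set R : (ℝ≥0 → ℝ) → ℝ≥0 → ℝ := fun w u ↦
    Process.pathRegularize w u - Process.pathRegularize w 0 with hR
  have hRc : ∀ w, Continuous (R w) := fun w ↦
    (Process.continuous_pathRegularize w).sub continuous_const
  have hR0 : ∀ w, R w 0 = 0 := fun w ↦ sub_self _
  have hRm : ∀ u, Measurable fun w ↦ R w u := fun u ↦
    (Process.measurable_pathRegularize u).sub (Process.measurable_pathRegularize 0)
  have hRid : ∀ w : ℝ≥0 → ℝ, Continuous w → w 0 = 0 → R w = w := by
    intro w hw hw0
    ext u
    simp [hR, Process.pathRegularize_eq_self_of_continuous hw, hw0]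
  -- the test points `xₙ = 1/(n+1)` and the path-space event
  set xs : ℕ → ℝ := fun n ↦ 1 / ((n : ℝ) + 1) with hxs
  have hxs_pos : ∀ n, 0 < xs n := fun n ↦ by rw [hxs]; positivity
  set S : Set (ℝ≥0 → ℝ) := {w | ∀ n m : ℕ,
    ((m : ℝ≥0) : WithTop ℝ≥0) < swallowingTime (R w) (xs n : ℂ)} with hS
  have hSm : MeasurableSet S := by
    have hS' : S = ⋂ n : ℕ, ⋂ m : ℕ,
        {w | ((m : ℝ≥0) : WithTop ℝ≥0) < swallowingTime (R w) (xs n : ℂ)} := by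
      ext w
      simp only [hS, mem_setOf_eq, mem_iInter]
    rw [hS']
    exact MeasurableSet.iInter fun n ↦ MeasurableSet.iInter fun m ↦
      measurableSet_lt_swallowingTime (W := R) (t := (m : ℝ≥0)) hRc hR0 (fun u _ ↦ hRm u)
        (hxs_pos n)
  -- for continuous paths from `0`, membership in `S` is the target property
  have hiff : ∀ w : ℝ≥0 → ℝ, Continuous w → w 0 = 0 →
      (w ∈ S ↔ ∀ x : ℝ, 0 < x → swallowingTime w x = ⊤) := by
    intro w hw hw0
    simp only [hS, mem_setOf_eq, hRid w hw hw0]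
    constructor
    · intro hw' x hx
      obtain ⟨n, hn⟩ := exists_nat_one_div_lt hx
      have hn' : xs n ≤ x := by rw [hxs]; exact hn.le
      have hle : swallowingTime w (xs n : ℂ) ≤ swallowingTime w x :=
        swallowingTime_mono_right hw (by rw [hw0]; exact hxs_pos n) hn'
      refine WithTop.eq_top_iff_forall_gt.2 fun r ↦ ?_
      obtain ⟨m, hm⟩ := exists_nat_gt r
      calc (r : WithTop ℝ≥0) < (m : ℝ≥0) := by exact_mod_cast hm
        _ < swallowingTime w (xs n : ℂ) := hw' n m
        _ ≤ swallowingTime w x := hle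
    · intro hw' n m
      rw [hw' _ (hxs_pos n)]
      exact WithTop.coe_lt_top _
  -- transfer through the identity in law
  have hm₁ : ∀ᵐ ω ∂P, W₁ ω ∈ S := by
    filter_upwards [h] with ω hω
    exact (hiff _ (hc₁ ω) (h0₁ ω)).2 hω
  have hm₂ : ∀ᵐ ω ∂P, W₂ ω ∈ S := by
    have h1 : P (W₁ ⁻¹' Sᶜ) = 0 := ae_iff.1 hm₁
    have h2 : P (W₂ ⁻¹' Sᶜ) = 0 := by
      rw [← hid.measure_mem_eq hSm.compl]
      exact h1
    exact ae_iff.2 h2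
  filter_upwards [hm₂] with ω hω
  exact (hiff _ (hc₂ ω) (h0₂ ω)).1 hω

end Loewner

/-! ### The Markov shift of the SLE driving function -/

section Markov

variable (κ : ℝ≥0)

/-- **Law of a transformed driving function.** Let `G` be an operation on real processes on the
canonical space which sends pre-Brownian motions to pre-Brownian motions (e.g. the Markov shift
`B ↦ B(s + ·) - B s`, Mathlib `IsPreBrownianReal.shift`, or its reflection, `IsPreBrownianReal.neg`)
and the zero process to itself, with `G B` jointly measurable in `ω` as a path. Then `√κ B` and
`√κ · G B` (`B = brownian` the canonical Brownian motion) have the same law on the path space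
`ℝ≥0 → ℝ`: all finite-dimensional laws agree (`identDistrib_iff_forall_finset_identDistrib`); in
the junk case `brownian = 0` both sides are the zero path. This is the Brownian input of
Rohde–Schramm (2005), Prop. 2.1 ("the scaling property easily follows from the scaling property
of Brownian motion, and the second property follows from the Markov property and translation
invariance of Brownian motion"). [cite: RohdeSchramm2005, Prop. 2.1] -/
theorem identDistrib_sleDriving_transform
    (G : (ℝ≥0 → (ℝ≥0 → ℝ) → ℝ) → ℝ≥0 → (ℝ≥0 → ℝ) → ℝ)
    (hG : ∀ B, IsPreBrownianReal B Process.preWienerMeasure →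
      IsPreBrownianReal (G B) Process.preWienerMeasure)
    (hG0 : G 0 = 0) (hm : Measurable fun (ω : ℝ≥0 → ℝ) (t : ℝ≥0) ↦ G Process.brownian t ω) :
    IdentDistrib (fun ω t ↦ sleDriving κ ω t) (fun ω t ↦ Real.sqrt κ * G Process.brownian t ω)
      Process.preWienerMeasure Process.preWienerMeasure := by
  have hm₁ : Measurable fun (ω : ℝ≥0 → ℝ) (t : ℝ≥0) ↦ sleDriving κ ω t :=
    measurable_sleDriving_pi κ
  have hm₂ : Measurable fun (ω : ℝ≥0 → ℝ) (t : ℝ≥0) ↦ Real.sqrt κ * G Process.brownian t ω :=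
    measurable_pi_lambda _ fun t ↦ ((measurable_pi_apply t).comp hm).const_mul _
  by_cases h : ∃ B : ℝ≥0 → (ℝ≥0 → ℝ) → ℝ, IsBrownianReal B Process.preWienerMeasure ∧
      (∀ t, Measurable (B t)) ∧ (∀ ω, Continuous (B · ω)) ∧ ∀ ω, B 0 ω = 0
  · have hB : IsBrownianReal Process.brownian Process.preWienerMeasure :=
      Process.isBrownianReal_brownian h
    haveI : IsProbabilityMeasure Process.preWienerMeasure := (hB.hasLaw ∅).isProbabilityMeasure
    have hB' : IsPreBrownianReal (G Process.brownian) Process.preWienerMeasure :=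
      hG _ hB.toIsPreBrownianReal
    rw [identDistrib_iff_forall_finset_identDistrib hm₁.aemeasurable hm₂.aemeasurable]
    intro J
    have hJ : IdentDistrib (fun ω ↦ J.restrict (Process.brownian · ω))
        (fun ω ↦ J.restrict fun t ↦ G Process.brownian t ω)
        Process.preWienerMeasure Process.preWienerMeasure :=
      ⟨(hB.hasLaw J).aemeasurable, (hB'.hasLaw J).aemeasurable,
        by rw [(hB.hasLaw J).map_eq, (hB'.hasLaw J).map_eq]⟩
    have hu : Measurable fun (v : J → ℝ) (i : J) ↦ Real.sqrt κ * v i :=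
      measurable_pi_lambda _ fun i ↦ (measurable_pi_apply i).const_mul _
    convert hJ.comp hu using 1
    · ext ω i
      simp [sleDriving]
    · ext ω i
      simp [Finset.restrict]
  · have hb : Process.brownian = 0 := by
      unfold Process.brownian
      rw [dif_neg h]
    have h0 : (fun (ω : ℝ≥0 → ℝ) (t : ℝ≥0) ↦ Real.sqrt κ * G Process.brownian t ω) =
        fun ω t ↦ sleDriving κ ω t := by
      ext ω t
      simp [sleDriving, hb, hG0]
    rw [h0]
    exact IdentDistrib.refl hm₁.aemeasurable

/-- **Markov shift of the SLE_κ driving function** (Rohde–Schramm (2005), Prop. 2.1 (ii) at the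
level of the driving function; Lawler (2005), §6.2 p. 150: "the distribution of `γˢ` is the same
as that of `γ`"): for every `s ≥ 0` the processes `t ↦ √κ B_t` and `t ↦ √κ B_{s+t} - √κ B_s`
have the same law on the path space `ℝ≥0 → ℝ`. From Mathlib's weak Markov property
`IsPreBrownianReal.shift` through `identDistrib_sleDriving_transform`.
[cite: RohdeSchramm2005, Prop. 2.1] -/
theorem identDistrib_sleDriving_shift (s : ℝ≥0) :
    IdentDistrib (fun ω t ↦ sleDriving κ ω t) (fun ω t ↦ sleDriving κ ω (s + t) - sleDriving κ ω s)
      Process.preWienerMeasure Process.preWienerMeasure := by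
  have h := identDistrib_sleDriving_transform κ (fun B t ω ↦ B (s + t) ω - B s ω)
    (fun B hB ↦ hB.shift s) (by ext; simp)
    (measurable_pi_lambda _ fun t ↦
      (Process.measurable_brownian _).sub (Process.measurable_brownian _))
  convert h using 2 with ω
  ext t
  simp only [sleDriving, mul_sub]

/-- **The reflected Markov shift**: `√κ B` and `t ↦ -(√κ B_{s+t} - √κ B_s)` have the same law on
the path space (Mathlib `IsPreBrownianReal.shift` and `IsPreBrownianReal.neg` through
`identDistrib_sleDriving_transform`; Rohde–Schramm (2005), §6 p. 901: "The proof that it a.s.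
does not intersect `(-∞, 0)` is the same"). [cite: RohdeSchramm2005, Prop. 2.1] -/
theorem identDistrib_sleDriving_neg_shift (s : ℝ≥0) :
    IdentDistrib (fun ω t ↦ sleDriving κ ω t)
      (fun ω t ↦ -(sleDriving κ ω (s + t) - sleDriving κ ω s))
      Process.preWienerMeasure Process.preWienerMeasure := by
  have h := identDistrib_sleDriving_transform κ (fun B t ω ↦ -(B (s + t) ω - B s ω))
    (fun B hB ↦ (hB.shift s).neg) (by ext; simp)
    (measurable_pi_lambda _ fun t ↦
      ((Process.measurable_brownian _).sub (Process.measurable_brownian _)).neg)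
  convert h using 2 with ω
  ext t
  simp only [sleDriving, mul_sub, mul_neg]

end Markov

/-! ### Assembly -/

section Assembly

variable {κ : ℝ≥0}

/-- Every path of the recentred shifted driving function `u ↦ ξ(s + u) - ξ(s)` is continuous.
[folklore] -/
theorem continuous_sleDriving_shift (κ : ℝ≥0) (ω : ℝ≥0 → ℝ) (s : ℝ≥0) :
    Continuous fun u ↦ sleDriving κ ω (s + u) - sleDriving κ ω s :=
  ((continuous_sleDriving κ ω).comp (continuous_const.add continuous_id)).sub continuous_const

/-- **No real point other than the starting point is swallowed by the shifted SLE_κ chain,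
`κ ≤ 4`** (from the named fact `sle_swallowingTime_ofReal_eq_top`, hypothesis `h68`): for every
`s ≥ 0`, almost surely every real `x ≠ 0` has `T_x = ⊤` under the Loewner flow driven by
`u ↦ ξ(s + u) - ξ(s)`. Positive points: the Markov shift in law
(`identDistrib_sleDriving_shift`) and the law transfer
`Loewner.ae_forall_swallowingTime_eq_top_of_identDistrib`; negative points: the same for the
reflected shift (`identDistrib_sleDriving_neg_shift`) and `T_{-x}(-V) = T_x(V)`
(`Loewner.swallowingTime_neg_ofReal`). This is Rohde–Schramm's use of Lemma 6.2 for the shifted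
chain `ĝ_t` via Prop. 2.1 (proof of Thm. 6.1, p. 902). [cite: RohdeSchramm2005, proof of Thm 6.1 (p. 902)] -/
theorem ae_forall_swallowingTime_shift_eq_top (h68 : sle_swallowingTime_ofReal_eq_top)
    (hκ : κ ≤ 4) (s : ℝ≥0) :
    ∀ᵐ ω ∂Process.preWienerMeasure, ∀ x : ℝ, x ≠ 0 →
      Loewner.swallowingTime (fun u ↦ sleDriving κ ω (s + u) - sleDriving κ ω s) x = ⊤ := by
  have hpos := Loewner.ae_forall_swallowingTime_eq_top_of_identDistrib
    (W₁ := fun ω t ↦ sleDriving κ ω t) (W₂ := fun ω u ↦ sleDriving κ ω (s + u) - sleDriving κ ω s)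
    (continuous_sleDriving κ) (fun ω ↦ continuous_sleDriving_shift κ ω s) (sleDriving_zero κ)
    (fun ω ↦ by simp) (identDistrib_sleDriving_shift κ s) (h68 hκ)
  have hneg := Loewner.ae_forall_swallowingTime_eq_top_of_identDistrib
    (W₁ := fun ω t ↦ sleDriving κ ω t)
    (W₂ := fun ω u ↦ -(sleDriving κ ω (s + u) - sleDriving κ ω s))
    (continuous_sleDriving κ) (fun ω ↦ (continuous_sleDriving_shift κ ω s).neg) (sleDriving_zero κ)
    (fun ω ↦ by simp) (identDistrib_sleDriving_neg_shift κ s) (h68 hκ)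
  filter_upwards [hpos, hneg] with ω h1 h2 x hx
  rcases lt_or_gt_of_ne hx with hx' | hx'
  · have h3 := h2 (-x) (neg_pos.2 hx')
    rwa [Loewner.swallowingTime_neg_ofReal] at h3
  · exact h1 x hx'

/-- **Rohde–Schramm (2005), Thm. 6.1 / Lawler (2005), Prop. 6.9, from two named facts.** The
simple phase `ae_isSimpleTrace_sleTrace_of_le_four` (for `0 < κ ≤ 4` the SLE_κ trace is a.s. a
simple path in `ℍₒ ∪ {0}`) follows from trace existence (`hasSLETrace_of_ne_eight`,
Rohde–Schramm Thm. 5.1, hypothesis `h51`) and the non-swallowing of positive real points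
(`sle_swallowingTime_ofReal_eq_top`, Lawler Prop. 6.8 (i) = Rohde–Schramm Lemma 6.2,
hypothesis `h68`): a.s. the chain is generated by its trace, and for every positive rational
`q`, a.s. the shifted chain swallows no real point but its starting point
(`ae_forall_swallowingTime_shift_eq_top`, un-recentred by `swallowingTime_add_const`); conclude
by the deterministic `Loewner.isSimpleTrace_trace_of_shift`. [cite: RohdeSchramm2005, Thm 6.1] -/
theorem ae_isSimpleTrace_sleTrace_of_le_four_of_facts (h51 : hasSLETrace_of_ne_eight)
    (h68 : sle_swallowingTime_ofReal_eq_top) : ae_isSimpleTrace_sleTrace_of_le_four (κ := κ) := by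
  intro _ hκ4
  have hκ8 : κ ≠ 8 := by
    intro h
    rw [h] at hκ4
    norm_num at hκ4
  have hgen : ∀ᵐ ω ∂Process.preWienerMeasure, ∃ γ, Loewner.IsGeneratedByCurve (sleDriving κ ω) γ :=
    h51 hκ8
  have hreal : ∀ᵐ ω ∂Process.preWienerMeasure, ∀ q : ℚ, 0 < q → ∀ x : ℝ,
      x ≠ sleDriving κ ω ((q : ℝ).toNNReal) →
        Loewner.swallowingTime (fun u ↦ sleDriving κ ω ((q : ℝ).toNNReal + u)) x = ⊤ := by
    rw [ae_all_iff]
    intro q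
    filter_upwards [ae_forall_swallowingTime_shift_eq_top h68 hκ4 ((q : ℝ).toNNReal)]
      with ω hω _ x hx
    set c : ℝ := sleDriving κ ω ((q : ℝ).toNNReal) with hc
    have h1 := hω (x - c) (sub_ne_zero.2 hx)
    have key := Loewner.swallowingTime_add_const
      (fun u ↦ sleDriving κ ω ((q : ℝ).toNNReal + u) - c) ((x - c : ℝ) : ℂ) c
    simp only [sub_add_cancel] at key
    rw [h1] at key
    have hxc : (((x - c : ℝ) : ℂ) + (c : ℂ)) = (x : ℂ) := by push_cast; ring
    rw [hxc] at key
    exact key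
  filter_upwards [hgen, hreal] with ω h1 h2
  exact Loewner.isSimpleTrace_trace_of_shift (continuous_sleDriving κ ω) h1 h2

/-- **Rohde–Schramm (2005), Lemma 6.2 as printed** (p. 901: "Let `κ ∈ [0, 4]`, and let `γ` be the
SLE_κ trace. Then a.s. `γ[0, ∞) ⊂ ℍ ∪ {0}`"), from the named fact
`sle_swallowingTime_ofReal_eq_top` alone (hypothesis `h68`; trace existence is not needed: when
the chain is not generated by a curve `sleTrace` is the constant path `0`): almost surely every
point of the trace is in the open upper half-plane or is `0`. For a chain generated by `γ`, the
swallowing time of a real `x ≠ 0` is the first hitting time of the closed real ray from `x`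
(`Loewner.swallowingTime_ofReal_eq_firstHit_of_ne`, Lawler Rem. 6.6); it is `⊤` for all `x ≠ 0`
a.s. (`ae_forall_swallowingTime_shift_eq_top` at `s = 0`), so `γ` misses `ℝ ∖ {0}`.
[cite: RohdeSchramm2005, Lemma 6.2] -/
theorem ae_sleTrace_im_pos_or_eq_zero (h68 : sle_swallowingTime_ofReal_eq_top) (hκ : κ ≤ 4) :
    ∀ᵐ ω ∂Process.preWienerMeasure, ∀ t : ℝ≥0, 0 < (sleTrace κ ω t).im ∨ sleTrace κ ω t = 0 := by
  filter_upwards [ae_forall_swallowingTime_shift_eq_top h68 hκ 0] with ω hω t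
  have hω' : ∀ x : ℝ, x ≠ 0 → Loewner.swallowingTime (sleDriving κ ω) x = ⊤ := by
    intro x hx
    have := hω x hx
    simpa using this
  by_cases hgen : ∃ γ, Loewner.IsGeneratedByCurve (sleDriving κ ω) γ
  · have hγ := Loewner.isGeneratedByCurve_trace hgen
    have him : 0 ≤ (sleTrace κ ω t).im := hγ.im_nonneg t
    rcases him.lt_or_eq with h | h
    · exact Or.inl h
    · right
      -- the trace point is real; it is not a nonzero real
      set x : ℝ := (sleTrace κ ω t).re with hx
      have hzx : sleTrace κ ω t = (x : ℂ) := Complex.ext (by simp [hx]) (by simp [← h])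
      by_contra hne
      have hx0 : x ≠ 0 := by
        intro h0
        exact hne (by rw [hzx, h0, Complex.ofReal_zero])
      have hT := hω' x hx0
      rw [Loewner.swallowingTime_ofReal_eq_firstHit_of_ne (continuous_sleDriving κ ω)
        (sleDriving_zero κ ω) hγ hx0] at hT
      have hlt : ((t : ℝ≥0) : WithTop ℝ≥0) < firstHit (sleTrace κ ω) (realRay x) := by
        change _ < firstHit (Loewner.trace (sleDriving κ ω)) (realRay x)
        rw [hT]
        exact WithTop.coe_lt_top t
      exact notMem_of_lt_firstHit hlt (by rw [hzx]; exact ofReal_mem_realRay x)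
  · right
    rw [sleTrace, Loewner.trace, dif_neg hgen]
    simp

end Assembly

end Literature.Probability.RandomPlanarGeometry
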